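import Summits.RiemannHypothesis.RiemannHypothesis.Theorems.LiTailMidpointLiPrimeTailResonantProof
import Summits.RiemannHypothesis.RiemannHypothesis.Theorems.LiTailMidpointLiBridgeHalves
import Summits.RiemannHypothesis.RiemannHypothesis.Theorems.LiTailMidpointAssembly
import HarnessLib

/-!
# RiemannHypothesis / LiTailMidpoint — the rung leaf «Li TAIL MIDPOINT LAW» `LiTheory.LiZeroTailMidpoint` is a tree theorem,
# and with it the ALL-CUTOFFS law `LiTheory.LiZeroTailLaguerreAll` (RH-FREE, PROOF-OF-DATA, NOT height-buying)

RH-FREE [rh-li-eng-4 g6].  Route `Theses/LiTailMidpoint.lean` (route-RiemannHypothesis-LiTailMidpoint, round 8 of the LI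
column, theory g10; rung L-P(P1-tail), PART M `Theorems/LiTailMidpointDefs.lean`).  Every binder of the route is CLOSED·proved in
the tree: K1 `liPrimeTailResonant_proof`, K2 `liBridgeHalves_proof` (DECIDING), `liTailMidpoint_assembly_proof` (all eng-4 g6;
the Assembly composition is theory g10's).  THIS FILE composes them with the planner's deciding theorem
`Theses.LiTailMidpoint.closes`:

  `liZeroTailMidpoint_proof : LiTheory.LiZeroTailMidpoint` — for every prime power `m` (`Λ(m) ≠ 0`) there is `C_m` with, for all
  `n ≥ 2`, `|liZeroTail n (c_m√n) − liSmoothTail n (c_m√n) + Σ_{2 ≤ k < m} liCoffeyTerm k n + liCoffeyTerm m n / 2| ≤ C_m log² n`,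
  `c_m = (log m)^{−1/2}`: at the resonant cut the zeros above `c_m√n` release EXACTLY HALF of `m`'s Laguerre term;

and, by PART M's proved glue `liZeroTailLaguerreAll_of` with round 7's leaf `liZeroTailLaguerre_proof`,

  `liZeroTailLaguerreAll_holds : LiTheory.LiZeroTailLaguerreAll` — the Li tail–Laguerre law for EVERY cutoff `c > 0` with the
  midpoint weights `liMidpointWeight c m ∈ {1, ½, 0}` (the Li-kernel analogue of `ψ₀(x) = ½(ψ(x⁺) + ψ(x⁻))` in the truncated
  explicit formula, with the roles of primes and zeros exchanged).

LABELS: RH-FREE for all `n`; statements about the finite explicit-formula bookkeeping of the zeros ABOVE height `c√n` (every zero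
summed whatever its real part); nothing here bears on the truth of RH; no data of record is added or changed.
-/

noncomputable section

-- D-0017: `Summit.<S>.<S>.…` is the designed namespace of a single-problem summit.
set_option linter.dupNamespace false

namespace Summit.RiemannHypothesis.RiemannHypothesis.Theorems.LiTheory

open Summit.RiemannHypothesis.RiemannHypothesis.Theses.LiTailMidpoint

/-- **The Li TAIL MIDPOINT LAW** (rung leaf `LiTheory.LiZeroTailMidpoint`, RH-FREE, PROOF-OF-DATA): the composition of the three
closed binders of route `LiTailMidpoint` by the planner's deciding theorem `closes`. -/
theorem liZeroTailMidpoint_proof : LiZeroTailMidpoint :=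
  closes liPrimeTailResonant_proof liBridgeHalves_proof liTailMidpoint_assembly_proof

/-- **The Li TAIL–LAGUERRE LAW AT EVERY CUTOFF** (PART M typed target `LiTheory.LiZeroTailLaguerreAll`, RH-FREE, now unconditional):
for every `c > 0` and all `n ≥ 2`,
`|liZeroTail n (c√n) − liSmoothTail n (c√n) + Σ_{2 ≤ m ≤ ⌊e^{1/c²}⌋} liMidpointWeight c m · liCoffeyTerm m n| ≤ C_c log² n`
— round 7's leaf off the resonances and round 8's leaf at them, glued by `liZeroTailLaguerreAll_of`. -/
theorem liZeroTailLaguerreAll_holds : LiZeroTailLaguerreAll :=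
  liZeroTailLaguerreAll_of liZeroTailLaguerre_proof liZeroTailMidpoint_proof

end Summit.RiemannHypothesis.RiemannHypothesis.Theorems.LiTheory

end
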